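import Literature.NumberTheory.LFunctions.MatomakiRadziwillTaoT2OfVK
import Literature.NumberTheory.LFunctions.VinogradovZetaSumEstimate
import HarnessLib

/-!
# Tao 2016, Theorem 1.2 for `λ` (log-averaged two-point Chowla) proved: `tao_log_chowla_liouville_holds`

Topic `Literature/NumberTheory/Sieve`; sibling proof file (one theorem, no new definitions, no named facts) of
`ParityWave0.lean` for the Wave-0 named fact `Literature.NumberTheory.Sieve.tao_log_chowla_liouville`
(**parity.S21**): T. Tao, *The logarithmically averaged Chowla and Elliott conjectures for two-point
correlations*, Forum Math. Pi **4** (2016), e8 = arXiv:1509.05422, **Theorem 1.2** (with `ω(x) = x`,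
`b₁, b₂ ≥ 0`, as in the abstract): for natural numbers `a₁, a₂` and `b₁, b₂` with `a₁ b₂ ≠ a₂ b₁`,
`∑_{n ≤ x} λ(a₁ n + b₁) λ(a₂ n + b₂) / n = o(log x)`.

The tree already contains the whole printed deduction; this file only joins its two leaves, which live in
modules neither of which imports the other:

* `MatomakiRadziwillTaoT2OfVK.lean`:
  `LFunctions.MRT2015.tao_log_chowla_liouville_of_vk :
     0 < c → LFunctions.HasVKZeroFreeRegion c T₀ → Sieve.tao_log_chowla_liouville`
  — Theorem 1.2 for `λ` from ANY Vinogradov–Korobov zero-free region for Dirichlet `L`-functions, along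
  Tao's own line: §1 (paragraph after Remark 1.6: "Corollary 1.5 implies Theorem 1.2", `λ` being
  non-pretentious — `Tao2016_liouvilleNonpretentious_holds`, proved in `LiouvilleNonpretentious.lean` from the
  van der Corput estimate for `ζ`, where the paper points to the Vinogradov–Korobov region) and §2 (first
  paragraph: for `λ` one may pass directly to Theorem 2.3, `tao_log_chowla_liouville_of_theorem23`);
  Theorem 2.3 from Proposition 2.4 (`Tao2016_theorem23_of_prop24`) and the proved core of its proof —
  Lemma 2.5, Proposition 2.6, the entropy decrement argument, Hoeffding's inequality, the circle method and the
  restriction theorem for the primes of §3 (`Tao2016.Tao2016_theorem23_core_holds`, `TaoLogElliottCore.lean`);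
  Proposition 2.4 (`MRT2015.Tao2016_prop24_of_vk`) from Matomäki–Radziwiłł–Tao 2015, Theorem 1.7 (saving
  `e^{-M/120}`), Theorem A.2 and Proposition A.3 in the restricted-Halász form with middle term
  `K (1 + M) e^{-M/2}` (`MRT2015.propA3With_exp_half_of_vk`: the window `𝒯₀ ∪ 𝒯₁` by Halász's theorem for
  block-restricted sums, the range `𝒯₂` by Lemma A.4 and Matomäki–Radziwiłł 2016, Proposition 1), the
  zero-free region entering through Matomäki–Radziwiłł's Lemma 11, Lemma A.4, the Halász window bound and the
  twisted prime sums far from the minimiser (the four `…_of_vk` inputs listed in that file's docstring);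
* `VinogradovZetaSumEstimate.lean`: `LFunctions.VKZeta.exists_hasVKZeroFreeRegion : ∃ c > 0, HasVKZeroFreeRegion c 21`
  — the Vinogradov–Korobov region, unconditionally, from the tree's Vinogradov mean value theorem
  (`vmvtBound_thirtyTwo`) through Ivić's Theorem 6.2, Ford's shape of the exponential-sum bound and
  Richert-type bounds.

Axiom closure of the theorem below: `propext`, `Classical.choice`, `Quot.sound`; no named fact remains on
this path.

## References

* T. Tao, *The logarithmically averaged Chowla and Elliott conjectures for two-point correlations*, Forum
  Math. Pi 4 (2016), e8, doi:10.1017/fmp.2016.6 = arXiv:1509.05422: Theorem 1.2, Theorem 1.3, Corollary 1.5,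
  §1 (paragraph after Remark 1.6), §2 (Theorem 2.3, Proposition 2.4, Lemma 2.5, Proposition 2.6), §3.
  [TaoFMP2016]
* K. Matomäki, M. Radziwiłł, T. Tao, *An averaged form of Chowla's conjecture*, Algebra & Number Theory 9
  (2015), 2167–2196: Theorem 1.7, (1.12), Appendix A (Theorem A.2, Proposition A.3, Lemma A.4).
  [MatomakiRadziwillTao2015]
* K. Matomäki, M. Radziwiłł, *Multiplicative functions in short intervals*, Ann. of Math. 183 (2016),
  Proposition 1, Lemma 11. [MatomakiRadziwillAnnals2016]
* A. Ivić, *The Riemann zeta-function* (1985), Theorems 6.1–6.2, Lemma 6.3. [Ivic1985]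

## Design choices

* A sibling file rather than an append to `ParityWave0.lean`: the proof imports modules that themselves
  import `ParityWave0.lean` (house pattern of `ParityWave0PolymathHolds.lean`, `ParityWave0IwaniecHolds.lean`).
* The inexplicit region `∃ c > 0, HasVKZeroFreeRegion c 21` is used, not Khale's explicit theorem
  (`Khale2024_zeroFreeRegion`, a named fact the `…_of_khale` theorems of the tree still take as a hypothesis).
-/

namespace Literature.NumberTheory.Sieve

/-- **Tao 2016, Theorem 1.2 for the Liouville function, PROVED**: for natural numbers `a₁, a₂ ≥ 1` and
`b₁, b₂` with `a₁ b₂ ≠ a₂ b₁`, `∑_{n ≤ x} λ(a₁ n + b₁) λ(a₂ n + b₂) / n = o(log x)`, i.e. the Wave-0 named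
fact `tao_log_chowla_liouville` (parity.S21) DISCHARGED along the printed proof: the Vinogradov–Korobov
zero-free region (`LFunctions.VKZeta.exists_hasVKZeroFreeRegion`, from Vinogradov's mean value theorem) fed
into `LFunctions.MRT2015.tao_log_chowla_liouville_of_vk` (Matomäki–Radziwiłł–Tao 2015, Prop. A.3 / Thm A.2 /
Thm 1.7; Tao 2016, Proposition 2.4, Theorem 2.3 with the entropy decrement argument of §3, and Theorem 1.2
for `λ` from Theorem 2.3 by the non-pretentiousness of `λ`, `Tao2016_liouvilleNonpretentious_holds`). All
axioms standard.
[cite: TaoFMP2016, Theorem 1.2 (ω(x) = x) and its proof via Corollary 1.5, Theorem 2.3, Proposition 2.4, §3] -/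
theorem tao_log_chowla_liouville_holds : tao_log_chowla_liouville := by
  obtain ⟨c, hc, hVK⟩ := LFunctions.VKZeta.exists_hasVKZeroFreeRegion
  exact LFunctions.MRT2015.tao_log_chowla_liouville_of_vk hc hVK

end Literature.NumberTheory.Sieve
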